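import Summits.BirchSwinnertonDyer.BirchSwinnertonDyer.Theorems.ErratumRoadFiveEulerHalfNotRamNoInertSetAtFiveOfSixItemsFrobenius
import Summits.BirchSwinnertonDyer.BirchSwinnertonDyer.Theorems.ErratumRoadFiveEulerHalfNotRamNoInertSetAtFiveOfSixItemsLowerX11aFive
import HarnessLib

/-!
# Route `ErratumRoadFive` (K2, `p ≥ 5`), crux `EulerHalfNotRamNoInertSetAtFive` (item stmt-BirchSwinnertonDyer-19715), line `birth` v17:
# BOTH CUTS AT ONCE — [GZ86 III (3.1)] OUT (the hGZ receptacle road of -w2 g6 ∕ -w5 g0 ∕ -w6 g0) AND the X11a input asked only at `p ≥ 5` (the LEAD's re-key):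
# **crux 19715 BY NAME ⟸ FIVE route items {19066, 19524, 19716, 20191, 20442} + item 23091 (Gross 1991 Prop. 3.7 (2)) + the `p ≥ 5` restriction of 19064**
# (cell `bsd-stepL`, LEAD `bsd-line-er5-p1` g4; `--supports stmt-BirchSwinnertonDyer-19715 --as helper`)

WHAT. The width seat -w2 g6's S1b-over-hGZ chain (`…JetchevAtPSupplyOfHGZ` p652455, `…JetchevAtPSwapEndOfHGZ` p654440, `…McCallumUpperOfHGZ`, `…EulerHalfPOnlyMultOfHGZ`,
`…NoInertSetOfHGZ`, `…NoInertSetAtFiveOfSixItemsFrobenius` with -w5 g0's modular auxiliary-norm supply `ModularAuxNorm.hGZ_of_onlyMult_of_galTrivial_of_kills`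
p652276 and -w6 g0's `CarrierLocalE0OddPrime` p648969) removes conjunct 2 of item 27981 ([GZ86 III (3.1)] `E⁰`) from the cone of 19715; the LEAD's
`…NoInertSetOfLowerX11aFive` (p655937) ∕ `…OfSixItemsLowerX11aFive` re-key the X11a input on its `p ≥ 5` restriction. This file composes the two:
* §1 `EulerHalfHGZ.res_pOnlyMultCarrierAtFive_of_items_of_frobeniusCongruence_of_hGZ_of_lowerX11aFive` (over -w2 g6's PER-PRIME consumer
  `JetchevMaxHLAtP.res_pOnlyMultCarrierAtFive_of_lowerX11aAt_of_hGZ`, p656631 — the X11a lower half bound at the pair's own prime, so the `p ≥ 5` restriction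
  feeds it by application) ∕
  `EulerHalfHGZ.eulerHalfNotRamNoInertSetAtFive_of_items_of_frobeniusCongruence_of_SAV_of_hGZ_of_lowerX11aFive` — -w2 g6's §1 ∕ §2 of `…NoInertSetOfHGZ` with
  the same restriction (the `p`-anchor branch through the LEAD's `EulerHalfPAnchor.eulerHalfNotRam_otherMult_of_pAnchor_of_lowerX11aFive`);
* §2 `EulerHalfLowerX11aFive.eulerHalfNotRamNoInertSetAtFive_of_fiveItems_of_frobeniusCongruence_of_lowerX11aFive (h₅ hJL hCO hCTi hESi)
  (hF₁ : GrossFrobeniusCongruenceImageFreeFact) (h₃ : ∀ Wd p, ClassX11a Wd p → 5 ≤ p → MissingLowerBoundAt Wd p) : EulerHalfNotRamNoInertSetAtFive`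
  (ROAD A SAV from `EulerHalfAuxNorm.shimuraInertSavedDisplayAtFive_of_items_of_threeLeaves` over the landed leaves; receptacle := `EulerHalfHGZ.hGZOnlyMult_of_modularAuxNorm`),
  `…_roadB` (SAV from `EulerHalfGalTrivialRoad.shimuraInertSavedDisplayAtFive_of_items`); -w2 g6's seven-binder statement `…_of_sixItems_of_frobeniusCongruence`
  follows by `lowerX11aFive_of_x11aLowerHalf` (p655937's companion; not restated: dedup).
WHAT THE LINE THEN SAYS: the open mathematics of 19715 = published inputs {19066, 19524, 19716, 20191 (closed), 20442, 23091} + the `p ≥ 5` part of crux 19064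
(= unit pairs free + ONE `∀`-certificate statement on the deep X11a pairs at `p ≥ 5` + print, per the 19064 line's r16). The skeleton's `_of` binds route ITEMS by
name (RULING 67); these closers are helpers until ∕ unless the planners re-type the binders.

HONEST FRAMING: THEOREMS ONLY — no definition, no named fact, no `sorry`; every theorem is CONDITIONAL on its displayed binders (route items by name = published
inputs typed as named facts; the `p ≥ 5` X11a restriction — OPEN, it contains Greenberg's `μ`-conjecture on the deep X11a locus at `p ≥ 5`). Nothing is booked; item
19715 is NOT closed (exact-match close only); no census number moves (404 = 69 + 334 + 1 + 0); BSD is proved for no curve; no summit statement is touched.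
-- adapted from Summits/BirchSwinnertonDyer/BirchSwinnertonDyer/Theorems/ErratumRoadFiveEulerHalfNotRamNoInertSetOfHGZ.lean (§1–§2), bodies verbatim, the X11a binder
-- restricted to `p ≥ 5`.
[cite: Jetchev2008, Thm. 1.1, Thm. 1.4, Cor. 1.5 (p. 812)] [cite: McCallumLMS1991, §5 Lemma 5.1, Cor. 5.6 (pp. 303, 310)] [cite: GrossLMS1991, Prop. 3.7 (2) (p. 240), §4 (4.1), §6 (p. 245)]
[cite: PastenShimura2024, Prop. 6.13, Lemma 6.18, §6.6] [cite: SilvermanATAEC1994, Cor. IV.9.2 (d)] [cite: MilneADT2006, Ch. I Thm. 4.10(b)] [cite: Cox2013, Thm. 8.12, §9.A]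
[cite: Miller2011LMS, §1, Def. 1.1]
-/

set_option autoImplicit false
set_option linter.dupNamespace false -- `Summit.BirchSwinnertonDyer.BirchSwinnertonDyer` (summit = problem), tree-wide

noncomputable section

open scoped Classical NumberField

/-! ### §1 The items-keyed S1b and the branching composition over the receptacle, X11a lower half at `p ≥ 5` -/

namespace Summit.BirchSwinnertonDyer.BirchSwinnertonDyer.Theorems.EulerHalfHGZ

open Summit.BirchSwinnertonDyer.BirchSwinnertonDyer.Theses.ErratumRoadFive
open WeierstrassCurve NumberField IsDedekindDomain
open Literature.NumberTheory.EllipticCurves Literature.NumberTheory.EllipticCurves.ModularForms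
  Literature.NumberTheory.EllipticCurves.Rank1Residual Literature.NumberTheory.EllipticCurves.Rank1Residual.Typed
open Summit.BirchSwinnertonDyer.Rank1Residual Summit.BirchSwinnertonDyer.Rank1Residual.X11b
  Summit.BirchSwinnertonDyer.Rank1Residual.X11b.Three.Koly Summit.BirchSwinnertonDyer.BirchSwinnertonDyer

/-- **S1b (+ the receptacle, placed last) from `PublishedInputsFive`, `ShimuraCasselsTateLevelInputs`, Gross 1991 Prop. 3.7 (2) image-free and the X11a lower
half AT `p ≥ 5`** — -w2 g6's `res_pOnlyMultCarrierAtFive_of_items_of_frobeniusCongruence_of_hGZ` with the item `X11aLowerHalf` replaced by its `p ≥ 5`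
restriction (over the per-prime consumer p656631). CONDITIONAL; no pair booked.
[cite: Jetchev2008, Thm. 1.4, Cor. 1.5] [cite: McCallumLMS1991, Cor. 5.6] [cite: GrossLMS1991, Prop. 3.7 (2), §4 (4.1)] [cite: MilneADT2006, Ch. I Thm. 4.10(b)] -/
theorem res_pOnlyMultCarrierAtFive_of_items_of_frobeniusCongruence_of_hGZ_of_lowerX11aFive
    (h₅ : PublishedInputsFive) (hCTi : ShimuraCasselsTateLevelInputs)
    (hF₁ : GrossLMS1991.prop37_2_frobeniusCongruence)
    (h₃ : ∀ (Wd : WeierstrassCurve ℚ) [Wd.IsElliptic] [Wd.IsGloballyMinimal] (p : ℕ) [Fact p.Prime],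
      ClassX11a Wd p → 5 ≤ p → Typed.MissingLowerBoundAt Wd p) :
    ∀ (W : WeierstrassCurve ℚ) [W.IsElliptic] [W.IsGloballyMinimal] (p : ℕ) [Fact p.Prime],
      ClassX11b W p → 5 ≤ p → Surj W p → ¬ Ram W p → p ∣ W.tamagawaProduct →
      (∀ (ℓ : ℕ) [Fact ℓ.Prime], W.HasMultiplicativeReductionAtPrime ℓ → ℓ = p) →
      W.HasSplitMultiplicativeReductionAtPrime p → p ∣ padicValInt p W.minimalDiscriminantInt →
      (∀ [NeZero (W.conductorNorm ℤ)] (K : Type) [Field K] [NumberField K], IsImaginaryQuadratic K →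
        NumberField.discr K < -4 → SatisfiesHeegnerHypothesis (W.conductorNorm ℤ) K →
        ∀ (Dt : ModularParametrizationData W (W.conductorNorm ℤ)) (β : ℤ) (ι : K →+* ℂ),
        ∃ n' : ℤ, IsCoprime (p : ℤ) n' ∧ ∀ (m : ℕ), Squarefree m →
        (∀ q ∈ m.primeFactors, Zhang2014.IsKolyvaginPrime (W.conductorNorm ℤ) W K p q) →
        ∀ (dm : KolyvaginHeegnerData Dt β ι m)
          (γ : ringClassField K ι m ≃ₐ[ℚ] ringClassField K ι m), γ ∈ ringClassGal ι m →
          ∀ v : HeightOneSpectrum (𝓞 K), ¬ (W.baseChange K).HasGoodReductionAt v →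
            n' • pointsMap (W.baseChange K) (v.adicCompletion K)
                (dm.toGeomPoints (pointGalHom W (ringClassField K ι m) γ dm.y)) ∈
              E0Receptacle (W.baseChange K) v ∧
            ∀ (ℓ : ℕ), ℓ ∈ m.primeFactors → ∀ (dm' : KolyvaginHeegnerData Dt β ι (m / ℓ))
              (hle : ringClassField K ι (m / ℓ) ≤ ringClassField K ι m),
              n' • pointsMap (W.baseChange K) (v.adicCompletion K)
                  (dm.toGeomPoints (pointGalHom W (ringClassField K ι m) γ
                    (WeierstrassCurve.Affine.Point.map (W' := W)
                      ((RingClassField.inclusion ι hle).restrictScalars ℚ) dm'.y))) ∈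
                E0Receptacle (W.baseChange K) v) →
      Typed.MissingUpperBoundAt W p := by
  obtain ⟨hGZ, hKo, -, -, -, hGZK, hmod, hnf, hHL, -, hMaz, -, -, -, -⟩ := h₅
  intro W _ _ p _ hX hp5 hsurj hram htam honly hsplit hdvd hRcpW
  exact JetchevMaxHLAtP.res_pOnlyMultCarrierAtFive_of_lowerX11aAt_of_hGZ hGZ hKo hGZK hmod hnf hHL hMaz
    (fun N _ W K _ _ ↦ heegnerPointOfConductor_one_galoisConj_holds N W K)
    (fun N _ W K _ _ ↦ phi_heegnerTau_mem_singularModuliField_holds N W K) hCTi hF₁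
    (poitouTate_conj_forall_of_selmerComplement_canonical
      fun K _ _ n _ ↦ SchneiderFreeAdditiveX3.PoitouTateReduction.selmerComplement_canonical_holds K n)
    W p hX hp5 hsurj hram htam honly hsplit hdvd (fun Wd _ _ hXa ↦ h₃ Wd p hXa hp5) hRcpW

/-- **CRUX 19715 BY NAME FROM FIVE ROUTE ITEMS + Gross Prop. 3.7 (2) + SAV + the receptacle + the X11a lower half AT `p ≥ 5`** — -w2 g6's
`eulerHalfNotRamNoInertSetAtFive_of_items_of_frobeniusCongruence_of_SAV_of_hGZ` with `X11aLowerHalf` replaced by its `p ≥ 5` restriction (S1b via the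
theorem above; the `p`-anchor via the LEAD's `EulerHalfPAnchor.eulerHalfNotRam_otherMult_of_pAnchor_of_lowerX11aFive`, p655937). CONDITIONAL; 19715 NOT closed.
[cite: Jetchev2008, Thm. 1.4, Cor. 1.5] [cite: PastenShimura2024, Prop. 6.13, Lemma 6.18, §6.6] [cite: SilvermanATAEC1994, Cor. IV.9.2 (d)] -/
theorem eulerHalfNotRamNoInertSetAtFive_of_items_of_frobeniusCongruence_of_SAV_of_hGZ_of_lowerX11aFive
    (h₅ : PublishedInputsFive)
    (h₃ : ∀ (Wd : WeierstrassCurve ℚ) [Wd.IsElliptic] [Wd.IsGloballyMinimal] (p : ℕ) [Fact p.Prime],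
      ClassX11a Wd p → 5 ≤ p → Typed.MissingLowerBoundAt Wd p)
    (hJL : ShimuraParametrizationDataNonempty)
    (hCO : PastenComponentOrdersInput) (hCTi : ShimuraCasselsTateLevelInputs)
    (hESi : ShimuraHeegnerEulerSystemInertPrintedR)
    (hF₁ : GrossLMS1991.prop37_2_frobeniusCongruence)
    (hSav : ∀ (W : WeierstrassCurve ℚ) [W.IsElliptic] [W.IsGloballyMinimal] (p : ℕ) [Fact p.Prime]
      (q₁ : ℕ) [Fact q₁.Prime], ClassX11b W p → 5 ≤ p → Surj W p → ¬ Ram W p →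
      W.HasSplitMultiplicativeReductionAtPrime q₁ → p ∣ padicValInt q₁ W.minimalDiscriminantInt →
      Theorems.ShimuraInertSavedDisplayAtD W p q₁)
    (hRcp : ∀ (W : WeierstrassCurve ℚ) [W.IsElliptic] [W.IsGloballyMinimal] (p : ℕ) [Fact p.Prime],
      ClassX11b W p → 5 ≤ p → Surj W p →
      (∀ (ℓ : ℕ) [Fact ℓ.Prime], W.HasMultiplicativeReductionAtPrime ℓ → ℓ = p) →
      W.HasSplitMultiplicativeReductionAtPrime p → p ∣ padicValInt p W.minimalDiscriminantInt →
      (∀ [NeZero (W.conductorNorm ℤ)] (K : Type) [Field K] [NumberField K], IsImaginaryQuadratic K →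
        NumberField.discr K < -4 → SatisfiesHeegnerHypothesis (W.conductorNorm ℤ) K →
        ∀ (Dt : ModularParametrizationData W (W.conductorNorm ℤ)) (β : ℤ) (ι : K →+* ℂ),
        ∃ n' : ℤ, IsCoprime (p : ℤ) n' ∧ ∀ (m : ℕ), Squarefree m →
        (∀ q ∈ m.primeFactors, Zhang2014.IsKolyvaginPrime (W.conductorNorm ℤ) W K p q) →
        ∀ (dm : KolyvaginHeegnerData Dt β ι m)
          (γ : ringClassField K ι m ≃ₐ[ℚ] ringClassField K ι m), γ ∈ ringClassGal ι m →
          ∀ v : HeightOneSpectrum (𝓞 K), ¬ (W.baseChange K).HasGoodReductionAt v →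
            n' • pointsMap (W.baseChange K) (v.adicCompletion K)
                (dm.toGeomPoints (pointGalHom W (ringClassField K ι m) γ dm.y)) ∈
              E0Receptacle (W.baseChange K) v ∧
            ∀ (ℓ : ℕ), ℓ ∈ m.primeFactors → ∀ (dm' : KolyvaginHeegnerData Dt β ι (m / ℓ))
              (hle : ringClassField K ι (m / ℓ) ≤ ringClassField K ι m),
              n' • pointsMap (W.baseChange K) (v.adicCompletion K)
                  (dm.toGeomPoints (pointGalHom W (ringClassField K ι m) γ
                    (WeierstrassCurve.Affine.Point.map (W' := W)
                      ((RingClassField.inclusion ι hle).restrictScalars ℚ) dm'.y))) ∈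
                E0Receptacle (W.baseChange K) v)) :
    EulerHalfNotRamNoInertSetAtFive := by
  intro W _ _ p _ hX hp5 hsurj hram htam _hno
  by_cases h : ∀ (ℓ : ℕ) [Fact ℓ.Prime], W.HasMultiplicativeReductionAtPrime ℓ → ℓ = p
  · -- `p` is the only multiplicative prime: the split carrier that `p ∣ ∏c` provides is multiplicative, hence it is `p`
    obtain ⟨ℓ, hℓ, hsplit, hdvd⟩ := (X11b.dvd_tamagawaProduct_iff_exists_split (W := W) (Fact.out : p.Prime) hp5).mp htam
    have hℓp : ℓ = p := h ℓ hsplit.hasMultiplicativeReductionAtPrime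
    subst hℓp
    exact res_pOnlyMultCarrierAtFive_of_items_of_frobeniusCongruence_of_hGZ_of_lowerX11aFive h₅ hCTi hF₁ h₃ W _ hX hp5 hsurj hram htam h
      hsplit hdvd (hRcp W _ hX hp5 hsurj h hsplit hdvd)
  · have hother : ∃ (ℓ : ℕ) (_ : Fact ℓ.Prime), ℓ ≠ p ∧ W.HasMultiplicativeReductionAtPrime ℓ := by
      by_contra hc
      exact h fun ℓ _ hm ↦ by_contra fun hne ↦ hc ⟨ℓ, ‹_›, hne, hm⟩
    exact Theorems.EulerHalfPAnchor.eulerHalfNotRam_otherMult_of_pAnchor_of_lowerX11aFive h₅ h₃ hJL hCO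
      (Theorems.EulerHalfPAnchor.shimuraInertDisplayKolyvagin_of_items h₅ hCTi hESi) hSav W p hX hp5 hsurj hram hother

end Summit.BirchSwinnertonDyer.BirchSwinnertonDyer.Theorems.EulerHalfHGZ

/-! ### §2 The crux BY NAME from FIVE route items + item 23091 + the `p ≥ 5` X11a lower half (both roads); monotonicity -/

namespace Summit.BirchSwinnertonDyer.BirchSwinnertonDyer.Theorems.EulerHalfLowerX11aFive

open Summit.BirchSwinnertonDyer.BirchSwinnertonDyer.Theses.ErratumRoadFive
open Literature.NumberTheory.EllipticCurves Literature.NumberTheory.EllipticCurves.Rank1Residual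
  Literature.NumberTheory.EllipticCurves.Rank1Residual.Typed
open Summit.BirchSwinnertonDyer.Rank1Residual Summit.BirchSwinnertonDyer.BirchSwinnertonDyer
  Summit.BirchSwinnertonDyer.BirchSwinnertonDyer.Theorems

/-- **CRUX 19715 `EulerHalfNotRamNoInertSetAtFive` BY NAME FROM FIVE ROUTE ITEMS + ITEM 23091 + THE `p ≥ 5` RESTRICTION OF `X11aLowerHalf` — ROAD A.**
`PublishedInputsFive` (19066), `ShimuraParametrizationDataNonempty` (19524), `PastenComponentOrdersInput` (19716), `ShimuraCasselsTateLevelInputs` (20191),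
`ShimuraHeegnerEulerSystemInertPrintedR` (20442), `GrossFrobeniusCongruenceImageFreeFact` (23091) and `∀ Wd p, ClassX11a Wd p → 5 ≤ p → MissingLowerBoundAt Wd p`.
:= §1 with SAV from `EulerHalfAuxNorm.shimuraInertSavedDisplayAtFive_of_items_of_threeLeaves` (leaves = the width seats' tree theorems, as p651418) and the
receptacle SUPPLIED by -w2 g6's `EulerHalfHGZ.hGZOnlyMult_of_modularAuxNorm` (-w5 g0's modular auxiliary norm + -w6 g0's carrier-local E′ analysis).
Neither [GZ86 III (3.1)] nor the `p = 3` part of crux 19064 is an input. CONDITIONAL; item 19715 stays ledger-`open`; BSD is proved for no curve.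
[cite: GrossLMS1991, Prop. 3.7 (2) (p. 240), §6 (p. 245)] [cite: Jetchev2008, Thm. 1.4, Cor. 1.5] [cite: PastenShimura2024, Lemma 6.18, Prop. 6.13] [cite: Cox2013, Thm. 8.12, §9.A] -/
theorem eulerHalfNotRamNoInertSetAtFive_of_fiveItems_of_frobeniusCongruence_of_lowerX11aFive
    (h₅ : PublishedInputsFive) (hJL : ShimuraParametrizationDataNonempty)
    (hCO : PastenComponentOrdersInput) (hCTi : ShimuraCasselsTateLevelInputs)
    (hESi : ShimuraHeegnerEulerSystemInertPrintedR) (hF₁ : GrossFrobeniusCongruenceImageFreeFact)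
    (h₃ : ∀ (Wd : WeierstrassCurve ℚ) [Wd.IsElliptic] [Wd.IsGloballyMinimal] (p : ℕ) [Fact p.Prime],
      ClassX11a Wd p → 5 ≤ p → MissingLowerBoundAt Wd p) :
    EulerHalfNotRamNoInertSetAtFive :=
  EulerHalfHGZ.eulerHalfNotRamNoInertSetAtFive_of_items_of_frobeniusCongruence_of_SAV_of_hGZ_of_lowerX11aFive h₅ h₃ hJL hCO hCTi hESi hF₁
    (EulerHalfAuxNorm.shimuraInertSavedDisplayAtFive_of_items_of_threeLeaves h₅ hCTi hESi
      (fun W _ _ K _ _ ι _ hK q _ hs hq2 ↦ TateComponent.stub_tateComponentFamilyLinear W K ι hK q hs hq2)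
      (fun W _ _ K _ _ hK hdK p _ hp5 hsurj ↦ stub_chebotarevKummerSupply W K hK hdK p hp5 hsurj)
      (fun K _ _ hK hdK p _ hp3 q _ hq2 ↦ stub_splitPrimeKummerWitness K hK hdK p hp3 q hq2))
    EulerHalfHGZ.hGZOnlyMult_of_modularAuxNorm

/-- **The same, ROAD B** (SAV from -w6 g0's `EulerHalfGalTrivialRoad.shimuraInertSavedDisplayAtFive_of_items`, p650861). CONDITIONAL; item 19715 stays
ledger-`open`; BSD is proved for no curve. [cite: GrossLMS1991, Prop. 3.7 (2), §6 p. 245] [cite: Jetchev2008, Thm. 1.4, Cor. 1.5] [cite: PastenShimura2024, Lemma 6.18] -/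
theorem eulerHalfNotRamNoInertSetAtFive_of_fiveItems_of_frobeniusCongruence_of_lowerX11aFive_roadB
    (h₅ : PublishedInputsFive) (hJL : ShimuraParametrizationDataNonempty)
    (hCO : PastenComponentOrdersInput) (hCTi : ShimuraCasselsTateLevelInputs)
    (hESi : ShimuraHeegnerEulerSystemInertPrintedR) (hF₁ : GrossFrobeniusCongruenceImageFreeFact)
    (h₃ : ∀ (Wd : WeierstrassCurve ℚ) [Wd.IsElliptic] [Wd.IsGloballyMinimal] (p : ℕ) [Fact p.Prime],
      ClassX11a Wd p → 5 ≤ p → MissingLowerBoundAt Wd p) :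
    EulerHalfNotRamNoInertSetAtFive :=
  EulerHalfHGZ.eulerHalfNotRamNoInertSetAtFive_of_items_of_frobeniusCongruence_of_SAV_of_hGZ_of_lowerX11aFive h₅ h₃ hJL hCO hCTi hESi hF₁
    (EulerHalfGalTrivialRoad.shimuraInertSavedDisplayAtFive_of_items h₅ hCTi hESi)
    EulerHalfHGZ.hGZOnlyMult_of_modularAuxNorm

end Summit.BirchSwinnertonDyer.BirchSwinnertonDyer.Theorems.EulerHalfLowerX11aFive

end
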